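import Literature.Geometry.DiscreteGeometry.UnitDiscBondSegments
import Mathlib.Dynamics.PeriodicPts.Defs
import Mathlib.Order.Preorder.Finite
import HarnessLib

/-!
# Tracing the boundary of the contact graph: the counter-clockwise successor and its orbit

Topic `Literature/Geometry/DiscreteGeometry`, fourth file of the proof of Harborth's upper bound
[Harborth1974, (5)]; sequel to `UnitDiscBondSegments.lean`. Harborth (p. 14): the straight bonds
decompose the plane into polygons, and "Es existiert daher ein einfach geschlossenes Randpolygon
mit `a` Eckpunkten". We construct that boundary polygon without any appeal to faces, by the
standard face-tracing rule of plane graphs applied to the outer face: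

* `Harborth.succ P q p` — arriving at the centre `p` from its neighbour `q`, the NEXT centre is
  the neighbour of `p` following `q` in the counter-clockwise order around `p` (the one at the
  least positive counter-clockwise angle from `q`; `q` itself if `p` has no other neighbour);
  `Harborth.gapAngle P q p` is that angle. By construction no bond at `p` points into the open
  angular gap `(0, gapAngle)` after `q` (`gapAngle_le_ccwAngle`), so the corner sector there is
  free of the drawing (`disjoint_cornerSector_drawing`), and `(deg p - 1) π/3 ≤ 2π - gapAngle`
  (`card_nbrs_sub_one_mul_le_gap`, Harborth's (2) at one vertex).
* `Harborth.next P (q, p) = (p, succ P q p)` — the face map on darts; it maps darts to darts and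
  is INJECTIVE on them when every centre has at least two neighbours (`next_injOn`), hence every
  dart is periodic (`exists_isPeriodicPt_next`).
* `Harborth.lowest P` / `Harborth.firstNbr` / `Harborth.lastNbr` — the lowest (then leftmost)
  centre `v₀` and its neighbours of least and greatest argument; the trace STARTS with the dart
  `(v₀, firstNbr)` and the dart before it in the orbit is `(lastNbr, v₀)` (`next_lastNbr`): at
  `v₀` the traced corner is the one containing the downward direction, so the orbit is the
  boundary of the OUTER face, run counter-clockwise.
* `Harborth.bdry P m` — the `m`-th centre of that orbit (`m : ℤ`, periodic with the minimal
  period `Harborth.period P`); consecutive centres are bonded, the turning rule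
  `bdry (m+2) = succ (bdry m) (bdry (m+1))` holds, and `bdry 0` is a lowest vertex.

The simplicity of this closed walk for non-splitting configurations, the Umlaufsatz count and
Harborth's inequality follow in `ContactGraphBoundaryCycle.lean`.
-/

noncomputable section

namespace Literature.Geometry.DiscreteGeometry

namespace Harborth

open Complex Set Finset Metric
open scoped Real

variable {P : Finset ℂ}

/-! ## §1 The counter-clockwise successor -/

/-- **The counter-clockwise successor**: arriving at `p` from the neighbour `q`, the neighbour of
`p` at the least positive counter-clockwise angle from `q` (or `q` itself if there is no other
neighbour). [cite: Harborth1974, p. 14] -/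
def succ (P : Finset ℂ) (q p : ℂ) : ℂ :=
  if h : ((nbrs P p).erase q).Nonempty then
    Classical.choose (((nbrs P p).erase q).exists_min_image (fun k => ccwAngle (q - p) (k - p)) h)
  else q

/-- The **gap angle** at `p` after `q`: the counter-clockwise angle from `q` to its successor.
[cite: Harborth1974, p. 14] -/
def gapAngle (P : Finset ℂ) (q p : ℂ) : ℝ := ccwAngle (q - p) (succ P q p - p)

/-- With another neighbour available, the successor is one of them, of least angle.
[cite: Harborth1974, p. 14] -/
theorem succ_spec {p q : ℂ} (h : ((nbrs P p).erase q).Nonempty) :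
    succ P q p ∈ (nbrs P p).erase q ∧
      ∀ k ∈ (nbrs P p).erase q, ccwAngle (q - p) (succ P q p - p) ≤ ccwAngle (q - p) (k - p) := by
  rw [succ, dif_pos h]
  exact Classical.choose_spec (((nbrs P p).erase q).exists_min_image
    (fun k => ccwAngle (q - p) (k - p)) h)

/-- Without another neighbour the successor is `q` itself (a U-turn). [cite: Harborth1974, p. 14] -/
theorem succ_of_not_nonempty {p q : ℂ} (h : ¬ ((nbrs P p).erase q).Nonempty) : succ P q p = q := by
  rw [succ, dif_neg h]

/-- A centre with at least two neighbours has another neighbour besides `q`. [folklore] -/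
private theorem erase_nonempty_of_two_le {p q : ℂ} (h2 : 2 ≤ (nbrs P p).card) :
    ((nbrs P p).erase q).Nonempty := by
  rw [← Finset.card_pos]
  have := Finset.pred_card_le_card_erase (s := nbrs P p) (a := q)
  omega

/-- The successor is a neighbour of `p` (given that `q` is). [cite: Harborth1974, p. 14] -/
theorem succ_mem_nbrs {p q : ℂ} (hq : q ∈ nbrs P p) : succ P q p ∈ nbrs P p := by
  by_cases h : ((nbrs P p).erase q).Nonempty
  · exact Finset.mem_of_mem_erase (succ_spec h).1
  · rw [succ_of_not_nonempty h]; exact hq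

/-- The successor differs from `q` as soon as `p` has two neighbours. [cite: Harborth1974, p. 14] -/
theorem succ_ne {p q : ℂ} (h2 : 2 ≤ (nbrs P p).card) : succ P q p ≠ q :=
  (Finset.mem_erase.1 (succ_spec (erase_nonempty_of_two_le h2)).1).1

/-- **The gap is empty**: every neighbour `k ≠ q` of `p` lies at counter-clockwise angle at least
`gapAngle P q p` from `q`. [cite: Harborth1974, p. 14] -/
theorem gapAngle_le_ccwAngle {p q k : ℂ} (hk : k ∈ nbrs P p) (hkq : k ≠ q) :
    gapAngle P q p ≤ ccwAngle (q - p) (k - p) :=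
  (succ_spec ⟨k, Finset.mem_erase.2 ⟨hkq, hk⟩⟩).2 k (Finset.mem_erase.2 ⟨hkq, hk⟩)

/-- The gap angle lies in `[π/3, 5π/3]` when `p` has at least two neighbours.
[cite: Harborth1974, p. 14] -/
theorem gapAngle_mem (hP : IsHard P) {p q : ℂ} (hq : q ∈ nbrs P p) (h2 : 2 ≤ (nbrs P p).card) :
    π / 3 ≤ gapAngle P q p ∧ gapAngle P q p ≤ 5 * π / 3 :=
  ccwAngle_nbrs hP hq (succ_mem_nbrs hq) (succ_ne h2).symm

/-- The gap angle is less than `2π`. [cite: Harborth1974, p. 14] -/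
theorem gapAngle_lt_two_pi (p q : ℂ) : gapAngle P q p < 2 * π := ccwAngle_lt_two_pi _ _

/-- The gap angle is non-negative. [cite: Harborth1974, p. 14] -/
theorem gapAngle_nonneg (p q : ℂ) : 0 ≤ gapAngle P q p := ccwAngle_nonneg _ _

/-- **The successor is determined by its angle**: a neighbour `k` at angle `gapAngle` from `q`
is the successor. [cite: Harborth1974, p. 14] -/
theorem eq_succ_of_ccwAngle_eq {p q k : ℂ} (hq : q ∈ nbrs P p) (hk : k ∈ nbrs P p)
    (h : ccwAngle (q - p) (k - p) = gapAngle P q p) : k = succ P q p := by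
  have hs := succ_mem_nbrs (P := P) hq
  rcases ccwAngle_add_ccwAngle (q - p) (succ P q p - p) (k - p) with h1 | h1
  · rw [h, gapAngle] at h1
    exact (eq_of_ccwAngle_eq_zero hs hk (by linarith)).symm
  · rw [h, gapAngle] at h1
    have := ccwAngle_lt_two_pi (succ P q p - p) (k - p)
    linarith

/-- **Harborth's (2) at one vertex**: `(deg p - 1) · π/3 ≤ 2π - gapAngle P q p` for a neighbour
`q` of `p` — the interior angle `2π - gapAngle` at a boundary vertex of type `j = deg p` is at
least `(j - 1)π/3`. [cite: Harborth1974, (2)] -/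
theorem card_nbrs_sub_one_mul_le_gap (hP : IsHard P) {p q : ℂ} (hq : q ∈ nbrs P p) :
    (((nbrs P p).card : ℝ) - 1) * (π / 3) ≤ 2 * π - gapAngle P q p :=
  card_nbrs_sub_one_mul_le_of_gap hP hq (gapAngle_lt_two_pi p q).le
    fun _ hk hkq => gapAngle_le_ccwAngle hk hkq

/-- The **corner sector** of the dart `(q, p)`: directions in the gap after `q` at `p`, radii
`< 1/2`. [cite: Harborth1974, p. 14] -/
def cornerSector (P : Finset ℂ) (q p : ℂ) : Set ℂ := sector p (q - p) 0 (gapAngle P q p) (1 / 2)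

/-- **Corners are free of the drawing.** [cite: Harborth1974, p. 14] -/
theorem disjoint_cornerSector_drawing (hP : IsHard P) {p q : ℂ} (hp : p ∈ P) :
    Disjoint (cornerSector P q p) (drawing P) :=
  disjoint_sector_drawing hP hp le_rfl fun _ hk hkq => gapAngle_le_ccwAngle hk hkq

/-- Corner sectors are preconnected. [cite: Harborth1974, p. 14] -/
theorem isPreconnected_cornerSector {p q : ℂ} (hq : q ∈ nbrs P p) : IsPreconnected (cornerSector P q p) :=
  isPreconnected_sector (norm_sub_eq_one_of_mem_nbrs hq) le_rfl (gapAngle_lt_two_pi p q).le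

/-- Corner sectors are non-empty when `p` has two neighbours. [cite: Harborth1974, p. 14] -/
theorem cornerSector_nonempty (hP : IsHard P) {p q : ℂ} (hq : q ∈ nbrs P p) (h2 : 2 ≤ (nbrs P p).card) :
    (cornerSector P q p).Nonempty := by
  have hγ := (gapAngle_mem hP hq h2).1
  have hπ := Real.pi_pos
  exact ⟨_, polar_mem_sector (norm_sub_eq_one_of_mem_nbrs hq) le_rfl (gapAngle_lt_two_pi p q).le
    (ρ := 1 / 4) (φ := gapAngle P q p / 2) (by norm_num) (by norm_num) (by linarith) (by linarith)⟩

/-! ## §2 The face map on darts -/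

/-- **The face map**: the dart `(q, p)` is followed by `(p, succ P q p)`. [cite: Harborth1974, p. 14] -/
def next (P : Finset ℂ) (d : ℂ × ℂ) : ℂ × ℂ := (d.2, succ P d.1 d.2)

/-- The tail of a dart is a neighbour of its head. [cite: Harborth1974, p. 14] -/
theorem fst_mem_nbrs_of_mem_darts {d : ℂ × ℂ} (hd : d ∈ darts P) : d.1 ∈ nbrs P d.2 := by
  obtain ⟨⟨h1, -⟩, h3⟩ := mem_darts.1 hd
  exact mem_nbrs.2 ⟨h1, by rw [norm_sub_rev]; exact h3⟩

/-- The head of a dart is a neighbour of its tail. [cite: Harborth1974, p. 14] -/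
theorem snd_mem_nbrs_of_mem_darts {d : ℂ × ℂ} (hd : d ∈ darts P) : d.2 ∈ nbrs P d.1 := by
  obtain ⟨⟨-, h2⟩, h3⟩ := mem_darts.1 hd
  exact mem_nbrs.2 ⟨h2, h3⟩

/-- A pair `(p, k)` with `k` a neighbour of `p ∈ P` is a dart. [cite: Harborth1974, p. 14] -/
theorem mk_mem_darts {p k : ℂ} (hp : p ∈ P) (hk : k ∈ nbrs P p) : (p, k) ∈ darts P :=
  mem_darts.2 ⟨⟨hp, (mem_nbrs.1 hk).1⟩, (mem_nbrs.1 hk).2⟩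

/-- For a dart written as a pair `(p, q)`: `q` is a neighbour of `p`. (Stated with the pair
explicit: unifying a projection of an unknown pair against `nbrs` is costly for the elaborator.)
[cite: Harborth1974, p. 14] -/
theorem mem_nbrs_of_mk_mem_darts {p q : ℂ} (h : (p, q) ∈ darts P) : q ∈ nbrs P p :=
  mem_nbrs.2 ⟨(mem_darts.1 h).1.2, (mem_darts.1 h).2⟩

/-- For a dart written as a pair `(p, q)`: `p` is a neighbour of `q`. [cite: Harborth1974, p. 14] -/
theorem mem_nbrs_of_mk_mem_darts' {p q : ℂ} (h : (p, q) ∈ darts P) : p ∈ nbrs P q :=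
  mem_nbrs.2 ⟨(mem_darts.1 h).1.1, by rw [norm_sub_rev]; exact (mem_darts.1 h).2⟩

/-- The face map sends darts to darts. [cite: Harborth1974, p. 14] -/
theorem next_mem_darts {d : ℂ × ℂ} (hd : d ∈ darts P) : next P d ∈ darts P :=
  mk_mem_darts (mem_darts.1 hd).1.2 (succ_mem_nbrs (fst_mem_nbrs_of_mem_darts hd))

/-- Iterates of the face map stay in the darts. [cite: Harborth1974, p. 14] -/
theorem iterate_next_mem_darts {d : ℂ × ℂ} (hd : d ∈ darts P) (m : ℕ) : (next P)^[m] d ∈ darts P := by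
  induction m with
  | zero => exact hd
  | succ m ih => rw [Function.iterate_succ_apply']; exact next_mem_darts ih

/-- **The face map is injective on darts** when every centre has at least two neighbours: the
predecessor of `(p, s)` is `(q, p)` with `q` the neighbour of `p` preceding `s` clockwise, and two
different neighbours cannot both have `s` as counter-clockwise successor (the later one would see
the earlier one before `s`). [cite: Harborth1974, p. 14] -/
theorem next_injOn (h2 : ∀ p ∈ P, 2 ≤ (nbrs P p).card) :
    Set.InjOn (next P) (darts P : Set (ℂ × ℂ)) := by
  intro d hd d' hd' h
  have hd := Finset.mem_coe.1 hd
  have hd' := Finset.mem_coe.1 hd'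
  simp only [next, Prod.mk.injEq] at h
  obtain ⟨hp, hs⟩ := h
  -- common head `p`, tails `q`, `q'`, common successor `s`
  have hq : d.1 ∈ nbrs P d.2 := fst_mem_nbrs_of_mem_darts hd
  have hq' : d'.1 ∈ nbrs P d.2 := by rw [hp]; exact fst_mem_nbrs_of_mem_darts hd'
  rw [← hp] at hs
  set p := d.2
  set q := d.1
  set q' := d'.1
  have hpP : p ∈ P := (mem_darts.1 hd).1.2
  have h2p := h2 p hpP
  by_contra hne
  have hqq' : q ≠ q' := fun h => hne (Prod.ext h hp)
  set s := succ P q p with hsdef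
  have hs_nb : s ∈ nbrs P p := succ_mem_nbrs hq
  have hsq : s ≠ q := succ_ne h2p
  have hsq' : s ≠ q' := by rw [hs]; exact succ_ne h2p
  -- minimality at `q` against `q'`, and at `q'` against `q`
  have m1 : ccwAngle (q - p) (s - p) ≤ ccwAngle (q - p) (q' - p) := gapAngle_le_ccwAngle hq' hqq'.symm
  have m2 : ccwAngle (q' - p) (s - p) ≤ ccwAngle (q' - p) (q - p) := by
    have := gapAngle_le_ccwAngle (P := P) (p := p) (q := q') hq hqq'
    rwa [gapAngle, ← hs] at this
  have hne0 : ccwAngle (q - p) (q' - p) ≠ 0 := fun h => hqq' (eq_of_ccwAngle_eq_zero hq hq' h)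
  have hrev := ccwAngle_rev hne0   -- ccwAngle (q'-p) (q-p) = 2π - ccwAngle (q-p) (q'-p)
  rcases ccwAngle_add_ccwAngle (q - p) (q' - p) (s - p) with h1 | h1
  · -- `ccw(q', s) = ccw(q, s) - ccw(q, q') ≤ 0`, so `s = q'`
    have h0 : ccwAngle (q' - p) (s - p) = 0 := by
      have := ccwAngle_nonneg (q' - p) (s - p); linarith
    exact hsq' (eq_of_ccwAngle_eq_zero hq' hs_nb h0).symm
  · -- `ccw(q', s) = ccw(q, s) + 2π - ccw(q, q') = ccw(q, s) + ccw(q', q) ≥ ccw(q', q)`: forces `s = q`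
    have h0 : ccwAngle (q - p) (s - p) = 0 := by
      have := ccwAngle_nonneg (q - p) (s - p); linarith
    exact hsq (eq_of_ccwAngle_eq_zero hq hs_nb h0).symm

/-- **Every dart is periodic under the face map** (injective self-map of a finite set).
[cite: Harborth1974, p. 14] -/
theorem exists_isPeriodicPt_next (h2 : ∀ p ∈ P, 2 ≤ (nbrs P p).card) {d : ℂ × ℂ}
    (hd : d ∈ darts P) : ∃ T, 0 < T ∧ Function.IsPeriodicPt (next P) T d := by
  obtain ⟨i, j, hij, heq⟩ := Set.Finite.exists_lt_map_eq_of_forall_mem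
    (f := fun m : ℕ => (next P)^[m] d) (fun m => Finset.mem_coe.2 (iterate_next_mem_darts hd m))
    (darts P).finite_toSet
  -- cancel `i` applications of the injective map
  have key : ∀ a b : ℕ, (next P)^[a + b] d = (next P)^[a] d → (next P)^[b] d = d := by
    intro a
    induction a with
    | zero => intro b h; simpa using h
    | succ a ih =>
      intro b h
      apply ih
      rw [show a + 1 + b = (a + b) + 1 by ring, Function.iterate_succ_apply',
        Function.iterate_succ_apply'] at h
      exact next_injOn h2 (Finset.mem_coe.2 (iterate_next_mem_darts hd _))
        (Finset.mem_coe.2 (iterate_next_mem_darts hd _)) h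
  refine ⟨j - i, by omega, ?_⟩
  have := key i (j - i) (by rw [show i + (j - i) = j by omega]; exact heq.symm)
  exact this

/-! ## §3 The lowest vertex and the start of the trace -/

/-- The configuration's **lowest-then-leftmost** order key. [folklore] -/
private def lowKey (p : ℂ) : ℝ ×ₗ ℝ := toLex (p.im, p.re)

/-- A lowest (then leftmost) centre of a non-empty configuration. [cite: Harborth1974, p. 14] -/
def lowest (P : Finset ℂ) (hP : P.Nonempty) : ℂ :=
  Classical.choose (P.exists_min_image lowKey hP)

/-- The lowest centre belongs to the configuration. [cite: Harborth1974, p. 14] -/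
theorem lowest_mem (hP : P.Nonempty) : lowest P hP ∈ P :=
  (Classical.choose_spec (P.exists_min_image lowKey hP)).1

/-- No centre is lower than the lowest one. [cite: Harborth1974, p. 14] -/
theorem im_lowest_le (hP : P.Nonempty) {p : ℂ} (hp : p ∈ P) : (lowest P hP).im ≤ p.im := by
  have h := (Classical.choose_spec (P.exists_min_image lowKey hP)).2 p hp
  change toLex ((lowest P hP).im, (lowest P hP).re) ≤ toLex (p.im, p.re) at h
  rcases Prod.Lex.le_iff.1 h with h1 | ⟨h1, -⟩
  · exact h1.le
  · exact h1.le

/-- Among the centres at the lowest height, the lowest one is leftmost. [cite: Harborth1974, p. 14] -/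
theorem re_lowest_le (hP : P.Nonempty) {p : ℂ} (hp : p ∈ P) (him : p.im = (lowest P hP).im) :
    (lowest P hP).re ≤ p.re := by
  have h := (Classical.choose_spec (P.exists_min_image lowKey hP)).2 p hp
  change toLex ((lowest P hP).im, (lowest P hP).re) ≤ toLex (p.im, p.re) at h
  rcases Prod.Lex.le_iff.1 h with h1 | ⟨-, h2⟩
  · exact absurd him.symm (ne_of_lt h1)
  · exact h2

/-- **The bonds at the lowest vertex point into the upper half-plane, not to the left**: for a
neighbour `k` of the lowest centre `v₀`, `0 ≤ arg (k - v₀) < π`. [cite: Harborth1974, p. 14] -/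
theorem arg_sub_lowest_mem (hne : P.Nonempty) {k : ℂ} (hk : k ∈ nbrs P (lowest P hne)) :
    0 ≤ arg (k - lowest P hne) ∧ arg (k - lowest P hne) < π := by
  set v := lowest P hne
  have hkP := (mem_nbrs.1 hk).1
  have him : 0 ≤ (k - v).im := by rw [sub_im]; linarith [im_lowest_le hne hkP]
  refine ⟨arg_nonneg_iff.2 him, lt_of_le_of_ne (arg_le_pi _) fun h => ?_⟩
  rw [arg_eq_pi_iff] at h
  -- `k` is straight to the left of `v`: same height, smaller real part
  have h1 : (k - v).im = 0 := h.2
  have h2 : (k - v).re < 0 := h.1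
  rw [sub_im, sub_eq_zero] at h1
  rw [sub_re] at h2
  have := re_lowest_le hne hkP h1
  linarith

/-- The **first neighbour** of the lowest centre: the one of least argument (the trace leaves
`v₀` along it). [cite: Harborth1974, p. 14] -/
def firstNbr (P : Finset ℂ) (hne : P.Nonempty) (h : (nbrs P (lowest P hne)).Nonempty) : ℂ :=
  Classical.choose ((nbrs P (lowest P hne)).exists_min_image (fun k => arg (k - lowest P hne)) h)

/-- The **last neighbour** of the lowest centre: the one of greatest argument (the trace returns
to `v₀` along it). [cite: Harborth1974, p. 14] -/
def lastNbr (P : Finset ℂ) (hne : P.Nonempty) (h : (nbrs P (lowest P hne)).Nonempty) : ℂ :=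
  Classical.choose ((nbrs P (lowest P hne)).exists_max_image (fun k => arg (k - lowest P hne)) h)

/-- Specification of the first neighbour. [cite: Harborth1974, p. 14] -/
theorem firstNbr_spec (hne : P.Nonempty) (h : (nbrs P (lowest P hne)).Nonempty) :
    firstNbr P hne h ∈ nbrs P (lowest P hne) ∧
      ∀ k ∈ nbrs P (lowest P hne), arg (firstNbr P hne h - lowest P hne) ≤ arg (k - lowest P hne) :=
  Classical.choose_spec ((nbrs P (lowest P hne)).exists_min_image (fun k => arg (k - lowest P hne)) h)

/-- Specification of the last neighbour. [cite: Harborth1974, p. 14] -/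
theorem lastNbr_spec (hne : P.Nonempty) (h : (nbrs P (lowest P hne)).Nonempty) :
    lastNbr P hne h ∈ nbrs P (lowest P hne) ∧
      ∀ k ∈ nbrs P (lowest P hne), arg (k - lowest P hne) ≤ arg (lastNbr P hne h - lowest P hne) :=
  Classical.choose_spec ((nbrs P (lowest P hne)).exists_max_image (fun k => arg (k - lowest P hne)) h)

/-- Distinct neighbours of a centre have distinct arguments. [cite: Harborth1974, p. 14] -/
theorem arg_ne_arg_of_ne {p q k : ℂ} (hq : q ∈ nbrs P p) (hk : k ∈ nbrs P p) (hne : q ≠ k) :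
    arg (q - p) ≠ arg (k - p) := fun h =>
  hne (eq_of_ccwAngle_eq_zero hq hk (ccwAngle_eq_zero_iff.2 h))

/-- At the lowest vertex, counter-clockwise angles from the last neighbour are
`arg k - arg last + 2π` for the other neighbours `k` (all arguments lie in `[0, π)`).
[cite: Harborth1974, p. 14] -/
theorem ccwAngle_lastNbr (hne : P.Nonempty) (h : (nbrs P (lowest P hne)).Nonempty) {k : ℂ}
    (hk : k ∈ nbrs P (lowest P hne)) (hkl : k ≠ lastNbr P hne h) :
    ccwAngle (lastNbr P hne h - lowest P hne) (k - lowest P hne) =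
      arg (k - lowest P hne) - arg (lastNbr P hne h - lowest P hne) + 2 * π := by
  set v := lowest P hne
  set l := lastNbr P hne h
  obtain ⟨hl, hmax⟩ := lastNbr_spec hne h
  have h1 := hmax k hk
  have h2 : arg (k - v) ≠ arg (l - v) := arg_ne_arg_of_ne hk hl hkl
  have h3 : arg (k - v) < arg (l - v) := lt_of_le_of_ne h1 h2
  have hk0 := (arg_sub_lowest_mem hne hk).1
  have hlπ := (arg_sub_lowest_mem hne hl).2
  refine ccwAngle_eq_of_coe_eq (by linarith) (by linarith) ?_
  rw [show arg (k - v) - arg (l - v) + 2 * π = (arg (k - v) - arg (l - v)) + 2 * π by ring,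
    Real.Angle.coe_add, Real.Angle.coe_two_pi, add_zero, Real.Angle.coe_sub]

/-- **The dart before the start**: arriving at the lowest centre from its last neighbour, the
trace leaves along the first neighbour — the traced corner at `v₀` is the one below `v₀`.
[cite: Harborth1974, p. 14] -/
theorem succ_lastNbr (hne : P.Nonempty) (h2 : 2 ≤ (nbrs P (lowest P hne)).card) :
    succ P (lastNbr P hne (Finset.card_pos.1 (by omega))) (lowest P hne) =
      firstNbr P hne (Finset.card_pos.1 (by omega)) := by
  have h : (nbrs P (lowest P hne)).Nonempty := Finset.card_pos.1 (by omega)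
  obtain ⟨hl, hmax⟩ := lastNbr_spec hne h
  obtain ⟨hf, hmin⟩ := firstNbr_spec hne h
  have hfl : firstNbr P hne h ≠ lastNbr P hne h := by
    intro hfl
    -- then all neighbours have the same argument: only one neighbour
    have hall : ∀ k ∈ nbrs P (lowest P hne), k = firstNbr P hne h := fun k hk => by
      by_contra hkf
      refine arg_ne_arg_of_ne hk hf hkf (le_antisymm ?_ (hmin k hk))
      rw [hfl]; exact hmax k hk
    have : (nbrs P (lowest P hne)).card ≤ 1 :=
      Finset.card_le_one.2 fun a ha b hb => by rw [hall a ha, hall b hb]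
    omega
  symm
  refine eq_succ_of_ccwAngle_eq hl hf (le_antisymm ?_ (gapAngle_le_ccwAngle hf hfl))
  -- the successor `s ≠ l` has `ccw(l, s) = arg s - arg l + 2π ≥ arg f - arg l + 2π = ccw(l, f)`
  have hs := succ_mem_nbrs (P := P) hl
  have hsl : succ P (lastNbr P hne h) (lowest P hne) ≠ lastNbr P hne h := succ_ne h2
  rw [gapAngle, ccwAngle_lastNbr hne h hs hsl, ccwAngle_lastNbr hne h hf hfl]
  linarith [hmin _ hs]

end Harborth

end Literature.Geometry.DiscreteGeometry

end
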